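import Summits.CriticalPhenomena.SAWScalingLimit.Theses.SAWDefectDecoherence
import Summits.CriticalPhenomena.SAWScalingLimit.Theorems.BoundaryClosureR.Negative.NormaliserPin
import Summits.CriticalPhenomena.SAWScalingLimit.Theorems.BoundaryClosureR.Negative.RootPin
import HarnessLib.Audit

/-!
# Line `runge-gated-green-pairing` — crux `SAWDefectDecoherence.BoundaryClosureR`
(stmt-CriticalPhenomena-14004, route-CriticalPhenomena-SAWDefectDecoherence, rank 4;
`BoundaryClosureR := DefectDecoherence → MassRatio → HexObservableLimitR`)

Skeleton (crux-plan, round 1) of the idea card `Ideas/runge-gated-green-pairing.md` (ideator 1;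
triage r1-1/2/3: pass ×3), with the panel's sharpenings built in (see `## Triage answers` in the
line card `Lines/runge-gated-green-pairing.md`).

THE LINE.  Write `Λ_δ(g) := δ² Σ_e g(δ·mid e) F_δ(e) / F_δ(b_δ)` for the `b`-normalised bulk pairing
of the `σ = 5/8` observable (the functional of the target `HexObservableLimitR`).  The exact
WEIGHTED GREEN IDENTITY `Σ_v u(v)·VR(v) = 0` (stub 1; DCS Lemma 1 summed against an arbitrary vertex
weight) is a discrete Stokes formula: bulk `∂̄`-pairing + `ū`-twisted (incoherent) pairing +
boundary flux = 0.  Feed it the weight `u = w(δ·c_v)` of a `C³` function `w` that VANISHES NEAR THE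
WHOLE FREE BOUNDARY `∂Ω ∖ gate`, the gate being the flat, lattice-exact piece at `b` (radius `ρ/4`
inside the pinned ball).  Then the free boundary — fjords, staircases, Kennedy–Lawler factors,
tangents — contributes NOTHING; the boundary flux lives on ONE exact zigzag row, where every
dangling edge is vertical of one class, `mid e − c_v = −iℓ/2` exactly and
`F_δ(e)/F_δ(b_δ) = Z_δ(e)/Z_δ(b_δ) > 0` (winding rigidity): a POSITIVE arrival measure
`α^b_δ := δ Σ_gate (Z_δ(e)/Z_δ(b_δ)) δ_{δ·mid e}`.  The twisted pairing is the route's decoherence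
debt, paid by `DefectDecoherence` + `MassRatio` in the bulk and by DD + the positive gate budget
(stub 2) in the gate layer (`δ Σ_{k ≤ η/δ} k^{3/4−θ} → 0` exactly because `θ > 3/4`, the route's
cut).  Result (stub 4, `GatePairingLimit`): the DISCRETE GREEN FORMULA ON THE GATE modulo
decoherence,
  `Λ_δ(∂̄w) + i√3 · ⟨α^b_δ, w⟩ → 0`      (`i√3 = i/ℓ`; mid-edge density `2√3 = 2/ℓ`).
Analysis supplies the test functions (stub 5, `RungeGate`): for `ψ ∈ C³_c(Ω)` the Cauchy
transform `Tψ` is holomorphic off `supp ψ`, hence ACROSS `∂Ω`; Runge on the filled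
`η/2`-neighbourhood of `∂Ω ∖ gate` (connected complement: inside and outside communicate through
the gate) gives a polynomial `h_ε` with `Tψ + h_ε` ε-small in `C²` on the collar, and
`w_ε := χ·(Tψ + h_ε)` has `∂̄w_ε = ψ + g_ε`, `‖g_ε‖ ≤ ε`, `supp g_ε ⊆ B` = a FIXED compact band
meeting `∂Ω` only in two feet on the flat row.  So `Λ_δ(ψ) = −i√3⟨α^b_δ, w_ε⟩ − Λ_δ(g_ε) + o(1)`
with `|Λ_δ(g_ε)| ≤ ε·C_B` (stub 3, `GateL1Bound`, the one a-priori bound, on compacts of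
`Ω ∪ open gate`; on compacts of `Ω` it is forced by the target, Banach–Steinhaus).  IF the positive
gate measures converge, `α^b_δ ⇀ m_b` with the conformal density
`m_b = (Φ'/Φ'(b))^{5/8} dx = e^{(5/8)(L̄ − L_b)} dx` (stub 6, `FlatGateProfile`, the load-bearing
open input: boundary shadow of Conj. 2 on the most rigid piece of geometry; engine = the sibling
line polygon-squeeze-flux-trace), then the numbers `−i√3⟨m_b, w_ε⟩` are Cauchy in `ε`, so
`Λ_δ(ψ)` CONVERGES (no subsequence, no normal family, no maximum principle), and the continuum
Green formula for the explicit holomorphic `f = e^{(5/8)(L − L_b)}` on smooth interior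
approximants, `∫∫_Ω ∂̄w_ε f = (1/2i) ∫_gate w_ε f dx`, identifies the limit as `2√3 ∫ ψ f` — the
universal constant is the LATTICE constant `c = 2√3` (stub 7, `GateClosing`, which also passes from
`C³` to continuous `ψ` by density + `GateL1Bound` on compacts of `Ω`).  The sorry-free part shrinks
the pin radius so that the two pinned balls are disjoint (the gate must avoid the root: phase jump
`e^{∓5πi/4}` across `a`), repackages the target's frame and proves `c = 2√3 ≠ 0`:
`GateTarget → HexObservableLimitR`, whence `BoundaryClosureR_of`.

REGISTERED STUBS (7) — composition `BoundaryClosureR_of` (sorry-free, concludes the crux BY NAME; it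
consumes the route's support item `BoundaryWindingRigidity` (stmt-8515) by name, exactly as
`DecoherenceSynthesis` does):
1. `stub_weightedGreenIdentity : WeightedGreenIdentity` — M, PROVABLE NOW (tree Lemma 1).
2. `stub_gateMassBudget : GateMassBudget` — L, open; POSITIVE masses only (row-`k` star mass above
   the exact floor `≤ C (k+1)^{3/4} Z_δ(b_δ)/δ`, predicted `(k+1)^{25/48}`; `k = 0` = wall row +
   gate arrival budget — triage r1-1 sharpen 1).
3. `stub_gateL1Bound : GateL1Bound` — XL, open; the a-priori `L¹` bound on compacts of
   `Ω ∪ open gate` (second hardest; necessary-type).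
4. `stub_discreteGreenOnGate : WeightedGreenIdentity → GateMassBudget → BoundaryWindingRigidity →
   DefectDecoherence → MassRatio → GatePairingLimit` — L–XL, provable given its inputs (Taylor
   bookkeeping of the identity; gate phase rigidity by the discrete Umlaufsatz; DD + MR in the
   bulk, DD + budget in the gate layer, budget on the wall rows; no `|F|` a-priori bound).
5. `stub_rungeGate : RungeGate` — L–XL, classical (Cauchy–Pompeiu, Runge, Cauchy estimates,
   cutoffs, Jordan exterior; Runge is not in Mathlib).
6. `stub_flatGateProfile : FlatGateProfile` — XL, OPEN, HARDEST and load-bearing.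
7. `stub_gateClosing : GatePairingLimit → RungeGate → FlatGateProfile → GateL1Bound → GateTarget`
   — L, classical given its inputs (Cauchy-in-ε existence, Green identification on `Ω_τ`, Schwarz
   reflection for `L̄`, the `L¹` bound on the cutoff band's feet, density `C³ → C⁰`).

Disproof.lean (cdisprove cycle 1) honoured: (F0) `not_crux_iff` — this is a PROOF line for `X`
given DD, MR (both consumed, in stub 4 only; `GateL1Bound` is consumed in stub 7 only); (F2) `target_false_without_normaliserPin` — the exact
half-lattice at `b` is used in stub 2 (rows counted from `m 1 δ`), stub 4 (gate coefficient `−iℓ/2`,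
one vertical class, `F/F(b_δ) = Z/Z(b_δ)`), stub 3 (feet of the band on the exact row) and stub 6
(all FALSE for the dead-end corridor at `b_δ`: `Z(e)/Z(b_δ) → ∞` next to the tip);
`target_false_without_rootPin` — the root pin is used exactly once, inside stub 6 (the profile is
that of `Φ` with its pole AT `pt 0`; for a Euclidean-only root the true profile follows the relocated
root), the gate pairing itself never reads the position of `a_δ` beyond `a_δ → pt 0 ∉` gate; (F3)
debts (i) = stub 3, (ii) eliminated (no free-boundary datum), (iii) never needed (no growth class /
RH uniqueness), (iv) built in (`c = 2√3` is a lattice constant; density 1 at `b` on the one-class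
row); (F4) harmless; (F6a) every gate statement lives inside the rigid ball; the imported landed
Negative lemmas (`Negative.NormaliserPin`, `Negative.RootPin`) elaborate with this file and no stub
is an instance they refute (every stub keeps BOTH pins: `PinnedFrame` is the target's frame
verbatim).  Negatives index (9): 5420 avoided (both pins everywhere), 8312 (one scalar over
disconnected regions: not the shape of any stub), 0772 (all-δ tightness: unused); the six
percolation / infinite-divisibility items are unrelated.
-/

noncomputable section

open scoped BigOperators Topology ComplexConjugate
open Filter Set MeasureTheory Metric
open Literature.Probability.LatticeModels (HexVertex hexGraph hexCenter)
open Literature.Probability.RandomPlanarGeometry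
open Literature.Probability.RandomPlanarGeometry.SAW

namespace Summit.CriticalPhenomena.SAWScalingLimit.Cruxes.BoundaryClosureR.RungeGatedGreenPairing

open Summit.CriticalPhenomena.SAWScalingLimit.Theses.SAWDefectDecoherence
  (HexObservableLimitR DefectDecoherence MassRatio BoundaryClosureR BoundaryWindingRigidity)

/-! ## Vocabulary -/

/-- The Wirtinger derivative `∂̄w(z) = ½ (∂ₓw + i ∂_y w)` of a real-differentiable `w : ℂ → ℂ`. -/
def dbar (w : ℂ → ℂ) (z : ℂ) : ℂ :=
  (fderiv ℝ w z 1 + Complex.I * fderiv ℝ w z Complex.I) / 2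

/-- The flat GATE at the normalisation point: the horizontal segment through `pt 1` of radius `r`
(for `r ≤ ρ` it lies on `∂Ω`, by the flat clause of the pinned frame). -/
def gateSeg (D : DobrushinDomain) (r : ℝ) : Set ℂ :=
  {z : ℂ | z.im = (D.pt 1).im} ∩ ball (D.pt 1) r

/-- **The pinned frame** — verbatim the hypothesis block of the target `HexObservableLimitR`
(stmt-CriticalPhenomena-14003) on `(D, ρ, Λ, m, a, b)`: radius `ρ > 0`; at BOTH marked points the
domain is the horizontal half-plane piece inside `ball (pt i) ρ`; eventually `Λ_δ` is simply
connected, `a_δ, b_δ` are boundary mid-edges joined by a SAW, `Λ_δ` is connected, lies inside `Ω`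
and is the EXACT half-lattice `{row ≥ m i δ}` inside each pinned ball; `Λ_δ` exhausts compacts;
`δ·mid a_δ → pt 0`, `δ·mid b_δ → pt 1`.  (Both lattice pins kept: Disproof §1.) -/
def PinnedFrame (D : DobrushinDomain) (ρ : ℝ) (Λ : ℝ → Finset HexVertex) (m : Fin 2 → ℝ → ℤ)
    (a b : ℝ → Sym2 HexVertex) : Prop :=
  0 < ρ ∧
  (∀ i : Fin 2, D.carrier ∩ ball (D.pt i) ρ = {z : ℂ | (D.pt i).im < z.im} ∩ ball (D.pt i) ρ) ∧
  (∀ᶠ δ : ℝ in 𝓝[>] 0,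
      hexDomainSimplyConnected (Λ δ) ∧ a δ ∈ hexDomainBoundary (Λ δ) ∧
        b δ ∈ hexDomainBoundary (Λ δ) ∧ Nonempty (HexMidEdgeSAW (Λ δ) (a δ) (b δ)) ∧
        (hexGraph.induce ((Λ δ : Finset HexVertex) : Set HexVertex)).Preconnected ∧
        (∀ v ∈ Λ δ, (δ : ℂ) * hexCenter v ∈ D.carrier) ∧
        (∀ i : Fin 2, ∀ v : HexVertex, (δ : ℂ) * hexCenter v ∈ ball (D.pt i) ρ →
          (v ∈ Λ δ ↔ m i δ ≤ v.1 1))) ∧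
  (∀ K : Set ℂ, IsCompact K → K ⊆ D.carrier → ∀ᶠ δ : ℝ in 𝓝[>] 0,
      ∀ v : HexVertex, (δ : ℂ) * hexCenter v ∈ K → v ∈ Λ δ) ∧
  Tendsto (fun δ : ℝ => (δ : ℂ) * hexMidpoint (a δ)) (𝓝[>] 0) (𝓝 (D.pt 0)) ∧
  Tendsto (fun δ : ℝ => (δ : ℂ) * hexMidpoint (b δ)) (𝓝[>] 0) (𝓝 (D.pt 1))

/-- **The conformal frame** — verbatim the target's data at the two marked points: `Φ : Ω → ℍ`
with `a ↦ ∞`, `b ↦ 0`, `L` a continuous logarithm of `Φ'` on `Ω` with limit `Lb` at `b`. -/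
def ConformalFrame (D : DobrushinDomain)
    (Φ : ConformalEquiv D.carrier UpperHalfPlane.upperHalfPlaneSet) (L : ℂ → ℂ) (Lb : ℂ) : Prop :=
  Tendsto (fun x => ‖Φ x‖) (𝓝[D.carrier] (D.pt 0)) atTop ∧ Φ.HasBoundaryValue (D.pt 1) 0 ∧
  ContinuousOn L D.carrier ∧ (∀ z ∈ D.carrier, Complex.exp (L z) = deriv Φ z) ∧
  Tendsto L (𝓝[D.carrier] (D.pt 1)) (𝓝 Lb)

/-! ## Typed statements of the line -/

/-- **WEIGHTED DISCRETE GREEN IDENTITY (the lever's exact first lemma; card + Ideator1Sketch,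
audited by the three triagers to `1e−14` with random complex weights).**  Multiply the vertex
relation at `v` (DCS Lemma 1, tree `DuminilCopinSmirnov2012_lemma1_holds`) by an arbitrary weight
`u v` and sum over `v ∈ Λ`: every interior edge `{v,w}` appears twice, with
`mid − c_v = (c_w − c_v)/2` and `mid − c_w = −(c_w − c_v)/2`, giving the interior part
`Σ_v Σ_{w ∈ Λ, w ∼ v} (c_w − c_v)(u v − u w) F{v,w}` (a discrete `∬ F ∂̄u` plus the `u_e²`-twisted
pairing), while every boundary mid-edge appears once, weighted by `u` at its inside vertex (the
discrete `∮ u F dz`).  With `u ≡ 1` it is `HexGreen.sum_relations_eq_hexFlux`. -/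
def WeightedGreenIdentity : Prop :=
  ∀ (Λ : Finset HexVertex), hexDomainSimplyConnected Λ → ∀ a ∈ hexDomainBoundary Λ,
    ∀ u : HexVertex → ℂ,
      let F : Sym2 HexVertex → ℂ := hexParafermionicObservable Λ a hexCriticalFugacity (5 / 8)
      (∑ v ∈ Λ, ∑ w ∈ Λ.filter (fun w => hexGraph.Adj v w),
          (hexCenter w - hexCenter v) * (u v - u w) * F s(v, w)) +
        4 * ∑ v ∈ Λ, u v * ∑ᶠ w ∈ {w : HexVertex | hexGraph.Adj v w ∧ w ∉ Λ},
          (hexMidpoint s(v, w) - hexCenter v) * F s(v, w) = 0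

/-- **GATE MASS BUDGET (positive masses only; merges the card's `GateMassGrowth` for `k ≥ 0` with
`FlatGateBudget`, as triage r1-1 sharpen 1 asks).**  In the pinned frame with the two balls
disjoint, there is `C` (per frame) such that eventually, for every height `k ≥ 0`, the total
`σ = 0` mass of the vertex stars of `Λ_δ` on row `m 1 δ + k` inside `ball (pt 1) (ρ/2)` is at most
`C (k+1)^{3/4} Z_δ(b_δ) / δ`.  The row `k = 0` contains the wall vertices AND their dangling (gate)
edges, so the gate arrival budget `δ Σ_gate Z_δ(e) ≤ C Z_δ(b_δ)` is the case `k = 0`.  Predicted: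
`(k+1)^{h_b − x₁} = (k+1)^{25/48}` times the row-`0` total, itself `≍ Z_δ(b_δ) · ρ/δ` (boundary
two-point function along the flat piece); only the exponent `3/4` (= the route's cut) is consumed. -/
def GateMassBudget : Prop :=
  ∀ (D : DobrushinDomain) (ρ : ℝ) (Λ : ℝ → Finset HexVertex) (m : Fin 2 → ℝ → ℤ)
    (a b : ℝ → Sym2 HexVertex),
    let Z : ℝ → Sym2 HexVertex → ℂ := fun δ z =>
      hexParafermionicObservable (Λ δ) (a δ) hexCriticalFugacity 0 z
    PinnedFrame D ρ Λ m a b → 2 * ρ < dist (D.pt 0) (D.pt 1) →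
    ∃ C : ℝ, ∀ᶠ δ : ℝ in 𝓝[>] 0, ∀ k : ℕ,
      δ * (∑ᶠ v ∈ {v : HexVertex | v ∈ Λ δ ∧ v.1 1 = m 1 δ + k ∧
            (δ : ℂ) * hexCenter v ∈ ball (D.pt 1) (ρ / 2)},
          ∑ᶠ t ∈ {t : HexVertex | hexGraph.Adj v t}, ‖Z δ s(v, t)‖) ≤
        C * ((k : ℝ) + 1) ^ (3 / 4 : ℝ) * ‖Z δ (b δ)‖

/-- **GATE L¹ BOUND (the one a-priori bound; card `GateL1Bound`, triage: "stays an input").**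
In the pinned frame with disjoint balls, for every compact `K ⊆ ℂ` whose trace on `Ω̄` avoids the
free boundary (`K ∩ Ω̄ ⊆ Ω ∪ gate`; lattice midpoints of floor edges may dip `δℓ/2` below the floor
line, whence `K` is not asked to lie inside `Ω̄`), the `F_δ(b_δ)`-normalised `L¹` mass of the
`σ = 5/8` observable over the mid-edges with `δ·mid e ∈ K` is eventually bounded.  On compacts of
`Ω` this is FORCED by the target (Banach–Steinhaus on `C_c(K°)`), equals WindingAlias'
`NormalisedMassBound` (stmt-14032) restricted, and is the exponent-sharp cancellation
`|F_δ| ≍ δ^{25/48} Z_δ` in the bulk (failure mode 2 of the crux); its extension to compacts touching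
the OPEN flat piece (the feet of the cutoff band) is the same statement in the rigid half-lattice
geometry, where conjecturally `F_δ/F_δ(b_δ) → (Φ'/Φ'(b))^{5/8}`, continuous up to the open gate. -/
def GateL1Bound : Prop :=
  ∀ (D : DobrushinDomain) (ρ : ℝ) (Λ : ℝ → Finset HexVertex) (m : Fin 2 → ℝ → ℤ)
    (a b : ℝ → Sym2 HexVertex),
    let F : ℝ → Sym2 HexVertex → ℂ := fun δ z =>
      hexParafermionicObservable (Λ δ) (a δ) hexCriticalFugacity (5 / 8) z
    PinnedFrame D ρ Λ m a b → 2 * ρ < dist (D.pt 0) (D.pt 1) →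
    ∀ K : Set ℂ, IsCompact K → K ∩ closure D.carrier ⊆ D.carrier ∪ gateSeg D ρ →
      ∃ C : ℝ, ∀ᶠ δ : ℝ in 𝓝[>] 0,
        δ ^ 2 * (∑ᶠ e ∈ {e : Sym2 HexVertex | e ∈ hexDomainMidEdges (Λ δ) ∧
            (δ : ℂ) * hexMidpoint e ∈ K}, ‖F δ e‖) ≤ C * ‖F δ (b δ)‖

/-- **DISCRETE GREEN FORMULA ON THE GATE modulo decoherence (`GatePairingLimit`, the node the
discrete half delivers).**  In the pinned frame with disjoint balls, for every `C³` weight `w` that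
vanishes on a neighbourhood of the free boundary `∂Ω ∖ ball (pt 1) (ρ/4)`:
`δ² Σ_{e ∈ Ω_δ} ∂̄w(δ·mid e) F_δ(e)/F_δ(b_δ) + i√3 · δ Σ_{e ∈ ∂Ω_δ, δ·mid e ∈ ball(pt 1) ρ}
 w(δ·mid e) Z_δ(e)/Z_δ(b_δ) → 0` as `δ → 0+` (`i√3 = i/ℓ`, `ℓ = 1/√3` the embedded edge length;
derivation: interior part of the identity `= −2δ Σ_e [(c_w−c_v)² ∂w + ℓ² ∂̄w](δ·mid e) F(e)
+ O(δ³‖w‖_{C³})·mass`, `(c_w − c_v)² = ∓ iℓ·conj(c_w − c_v)` groups the twisted part by black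
vertex into the route's defects `T(v)`; boundary part `= −2iℓ Σ_gate w(δ c_v) F(e)`).  Continuum
check: with `F/F(b) → f` holomorphic and `α^b_δ ⇀ f|_gate dx` it reads
`2√3 ∫∫ ∂̄w f + i√3 ∫ w f dx = 0`, i.e. Green's formula `∫∫_Ω ∂̄(wf) = (1/2i)∫_{∂Ω} wf dz`. -/
def GatePairingLimit : Prop :=
  ∀ (D : DobrushinDomain) (ρ : ℝ) (Λ : ℝ → Finset HexVertex) (m : Fin 2 → ℝ → ℤ)
    (a b : ℝ → Sym2 HexVertex),
    let F : ℝ → Sym2 HexVertex → ℂ := fun δ z =>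
      hexParafermionicObservable (Λ δ) (a δ) hexCriticalFugacity (5 / 8) z
    let Z : ℝ → Sym2 HexVertex → ℂ := fun δ z =>
      hexParafermionicObservable (Λ δ) (a δ) hexCriticalFugacity 0 z
    PinnedFrame D ρ Λ m a b → 2 * ρ < dist (D.pt 0) (D.pt 1) →
    ∀ w : ℂ → ℂ, ContDiff ℝ 3 w →
      (∃ U : Set ℂ, IsOpen U ∧ frontier D.carrier \ ball (D.pt 1) (ρ / 4) ⊆ U ∧ ∀ z ∈ U, w z = 0) →
      Tendsto (fun δ : ℝ =>
          (δ : ℂ) ^ 2 * (∑ᶠ e ∈ hexDomainMidEdges (Λ δ),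
              dbar w ((δ : ℂ) * hexMidpoint e) * F δ e) / F δ (b δ) +
            Complex.I * (Real.sqrt 3 : ℂ) * ((δ : ℂ) *
              ∑ᶠ e ∈ {e : Sym2 HexVertex | e ∈ hexDomainBoundary (Λ δ) ∧
                  (δ : ℂ) * hexMidpoint e ∈ ball (D.pt 1) ρ},
                w ((δ : ℂ) * hexMidpoint e) * (Z δ e / Z δ (b δ))))
        (𝓝[>] 0) (𝓝 0)

/-- **RUNGE GATE (pure complex analysis: gated approximate `∂̄`-primitives).**  For a Dobrushin
(Jordan) domain flat inside `ball (pt 1) ρ` and a `C³` test function `ψ` compactly supported in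
`Ω`, there is a FIXED compact band `B` whose trace on `Ω̄` avoids the free boundary
(`B ∩ Ω̄ ⊆ Ω ∪ gateSeg (ρ/2)`: it meets `∂Ω` only in two feet on the flat row) such that for every
`ε > 0` some `C³` function `w` vanishes on a neighbourhood of `∂Ω ∖ ball (pt 1) (ρ/4)` and has
`∂̄w = ψ` off `B` and `‖∂̄w − ψ‖ ≤ ε` everywhere.  Construction: `w = χ·(Tψ + h_ε)` with `Tψ` the
Cauchy transform (`∂̄Tψ = ψ`, holomorphic off `supp ψ`, so across `∂Ω`), `χ` a smooth cutoff
killing the `η/4`-collar of `A := ∂Ω ∖ ball (pt 1) (ρ/4)` and `≡ 1` off its `η/2`-collar, and `h_ε`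
a Runge POLYNOMIAL with `‖Tψ + h_ε‖_{C²} ≤ εη/‖χ‖_{C¹}` on the filled `η/2`-neighbourhood `N̂` of
`A` — legitimate because `ℂ ∖ N` is connected through the gate gap and `supp ψ` lies in its
unbounded component once `η < η₀(Ω, supp ψ, ρ)` (`Ω` connected, Jordan exterior connected and
unbounded); `B := {η/4 ≤ dist(·, A) ≤ η/2}`.  Runge's theorem, `C^k` Cauchy estimates and
Cauchy–Pompeiu for `C^k_c` data are not in Mathlib (to be vendored). -/
def RungeGate : Prop :=
  ∀ (D : DobrushinDomain) (ρ : ℝ), 0 < ρ →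
    D.carrier ∩ ball (D.pt 1) ρ = {z : ℂ | (D.pt 1).im < z.im} ∩ ball (D.pt 1) ρ →
    ∀ ψ : ℂ → ℂ, ContDiff ℝ 3 ψ → HasCompactSupport ψ → tsupport ψ ⊆ D.carrier →
      ∃ B : Set ℂ, IsCompact B ∧ B ∩ closure D.carrier ⊆ D.carrier ∪ gateSeg D (ρ / 2) ∧
        ∀ ε : ℝ, 0 < ε → ∃ w : ℂ → ℂ, ContDiff ℝ 3 w ∧
          (∃ U : Set ℂ, IsOpen U ∧ frontier D.carrier \ ball (D.pt 1) (ρ / 4) ⊆ U ∧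
            ∀ z ∈ U, w z = 0) ∧
          (∀ z : ℂ, ‖dbar w z - ψ z‖ ≤ ε) ∧
          (∀ z : ℂ, z ∉ B → dbar w z = ψ z)

/-- **FLAT GATE PROFILE (the load-bearing OPEN INPUT; `σ = 0`, one edge class, positive masses;
card + Ideator1Sketch, with the disjoint-balls clause of triage r1-3 sharpen 1).**  In the pinned
frame with disjoint balls and the conformal frame, for any continuous extension `L̄` of `L = log Φ'`
to `Ω ∪ gate` (it exists by Schwarz reflection across the flat piece, the gate avoiding the pole at
`a`) and every `g ∈ C_c(ball (pt 1) ρ)`: the `Z_δ(b_δ)`-normalised arrival measure of the gate,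
`α^b_δ := δ Σ_{e ∈ ∂Ω_δ, δ·mid e ∈ ball(pt 1) ρ} (Z_δ(e)/Z_δ(b_δ)) δ_{δ·mid e}`, converges against
`g` to `∫ g(x + i·im b) e^{(5/8)(L̄(x + i·im b) − L_b)} dx = ∫ g (Φ'(x)/Φ'(b))^{5/8} dx` (real,
positive density `1` at `b`; dangling edges of a zigzag row are spaced `1` apart, whence no extra
constant).  The boundary shadow of DCS Conjecture 2 / Lawler's `Z_D(a,x) ∝ |f'(a) f'(x)|^{5/8}`
restricted to ONE exact flat row; the root pin enters the line HERE and only here (`Φ` has its pole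
at `pt 0`).  ENGINE (sibling line `polygon-squeeze-flux-trace`): monotone squeeze of positive
arrival masses between canonical hex-polygons `P_δ ⊆ Λ_δ ⊆ P'_δ` + `PolygonCase` +
`CollarAvoidance` ⇒ this statement for general `(Ω, Λ_δ)`; direct falsifier: rectangle transfer
matrices `W = 6…12` against the elliptic-function prediction. -/
def FlatGateProfile : Prop :=
  ∀ (D : DobrushinDomain) (ρ : ℝ) (Λ : ℝ → Finset HexVertex) (m : Fin 2 → ℝ → ℤ)
    (a b : ℝ → Sym2 HexVertex) (Φ : ConformalEquiv D.carrier UpperHalfPlane.upperHalfPlaneSet)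
    (L : ℂ → ℂ) (Lb : ℂ) (Lbar : ℂ → ℂ) (g : ℂ → ℂ),
    let Z : ℝ → Sym2 HexVertex → ℂ := fun δ z =>
      hexParafermionicObservable (Λ δ) (a δ) hexCriticalFugacity 0 z
    PinnedFrame D ρ Λ m a b → 2 * ρ < dist (D.pt 0) (D.pt 1) → ConformalFrame D Φ L Lb →
    ContinuousOn Lbar (D.carrier ∪ gateSeg D ρ) → EqOn Lbar L D.carrier →
    Continuous g → HasCompactSupport g → tsupport g ⊆ ball (D.pt 1) ρ →
    Tendsto (fun δ : ℝ => (δ : ℂ) *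
        ∑ᶠ e ∈ {e : Sym2 HexVertex | e ∈ hexDomainBoundary (Λ δ) ∧
            (δ : ℂ) * hexMidpoint e ∈ ball (D.pt 1) ρ},
          g ((δ : ℂ) * hexMidpoint e) * (Z δ e / Z δ (b δ)))
      (𝓝[>] 0)
      (𝓝 (∫ x in Set.Ioo ((D.pt 1).re - ρ) ((D.pt 1).re + ρ),
        g ((x : ℂ) + ((D.pt 1).im : ℂ) * Complex.I) *
          Complex.exp ((5 / 8 : ℂ) * (Lbar ((x : ℂ) + ((D.pt 1).im : ℂ) * Complex.I) - Lb))))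

/-- **GATE TARGET** — the target `HexObservableLimitR` per frame, with the pinned balls DISJOINT
(`2ρ < |pt 0 − pt 1|`; the general case follows by shrinking `ρ`, sorry-free below) and the
universal constant made EXPLICIT: `c = 2√3`, the number of mid-edges per unit area of the embedded
honeycomb (`= 2/ℓ`; triage r1-1/r1-3 cross-check of cards 1 and 6).  A measured `c ≠ 2√3` in the
route's Monte-Carlo (bulk averages at `R ≫ 10`) refutes the line's bookkeeping, not the crux. -/
def GateTarget : Prop :=
  ∀ (D : DobrushinDomain) (ρ : ℝ) (Λ : ℝ → Finset HexVertex) (m : Fin 2 → ℝ → ℤ)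
    (a b : ℝ → Sym2 HexVertex) (Φ : ConformalEquiv D.carrier UpperHalfPlane.upperHalfPlaneSet)
    (L : ℂ → ℂ) (Lb : ℂ) (ψ : ℂ → ℂ),
    let F : ℝ → Sym2 HexVertex → ℂ := fun δ z =>
      hexParafermionicObservable (Λ δ) (a δ) hexCriticalFugacity (5 / 8) z
    PinnedFrame D ρ Λ m a b → 2 * ρ < dist (D.pt 0) (D.pt 1) → ConformalFrame D Φ L Lb →
    Continuous ψ → HasCompactSupport ψ → tsupport ψ ⊆ D.carrier →
    Tendsto (fun δ : ℝ => (δ : ℂ) ^ 2 * (∑ᶠ e ∈ hexDomainMidEdges (Λ δ),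
      ψ ((δ : ℂ) * hexMidpoint e) * F δ e) / F δ (b δ)) (𝓝[>] 0)
      (𝓝 (((2 * Real.sqrt 3 : ℝ) : ℂ) * ∫ z, ψ z * Complex.exp ((5 / 8 : ℂ) * (L z - Lb))))

/-! ## Registered stubs -/

/-- STUB 1 — `WeightedGreenIdentity` (size M; PROVABLE NOW).  `hexCriticalFugacity` is
definitionally `(√(2+√2))⁻¹`, so `DuminilCopinSmirnov2012_lemma1_holds` (HexParafermionProofs)
applies verbatim; the rest is the finite rearrangement `Σ_v u_v · VR(v) = 0` (ordered interior
pairs give the double sum with the factor `(c_w − c_v)/2 · 2`, edges leaving `Λ` appear once) —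
bookkeeping of `HexGreen.sum_relations_eq_hexFlux` (ParafermionicHalfCauchyRiemann.lean) with a
weight.  Shared first lemma of three cards (runge / dressed-arrival / polygon-squeeze): land it ONCE
as a tree lemma.  Sources: arXiv:1007.0575 Lemma 1 and eq. (2); card First lemma; TRIAGE r1-1 (i),
r1-2 (i), r1-3 (exact lemmas). -/
theorem stub_weightedGreenIdentity : WeightedGreenIdentity := by
  sorry

/-- STUB 2 — `GateMassBudget` (size L; OPEN, positive-measure species — no phases, no `|F|`).
Why plausible: one-sided boundary Harnack comparability of POSITIVE `x_c`-weighted arrival masses on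
and above ONE exact zigzag row: (k = 0) every walk reaching an interior half-edge at a wall vertex
from the far side extends to the dangling edge at cost `x_c` (2-step local surgery, TRIAGE r1-1
sharpen 1), and the dangling masses along the row are comparable to `Z_δ(b_δ)` per unit length
(row total `× δ = O(Z_δ(b_δ))`: boundary two-point function along a flat piece, predicted density
`(Φ'/Φ'(b))^{5/8}`, bounded on the closed half-ball since the root's ball is disjoint); (k ≥ 1)
moving the endpoint `k` rows into the bulk gains at most `(k+1)^{3/4}` (predicted
`(k+1)^{h_b − x₁} = (k+1)^{25/48}`, margin `11/48`).  Tools: bridge decompositions / unfolding in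
the half-lattice (tree `HexSAWBridges`, `HexSAWBridgeDecay`, `DuminilCopinSmirnov2012_lemma2_holds`:
`Σ_β x_c^ℓ ≤ 1` type bounds), restriction monotonicity of `σ = 0` masses in the domain.  Why it
might fail: the exponent `3/4` must beat the true boundary-to-bulk gain uniformly in `k ≤ ρ/(2δ)`
and in the rough collar far from the ball (walks may wander out of the ball and back); a mass-ratio
exponent `≥ 3/4` forces the route's one allowed re-cut (KILL CRITERIA).  Cheapest falsifier: the
card's rectangle transfer matrices (`W = 6…12`): row-`k` star mass / row-`0` mass `∝ k^{25/48}`.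
Sources: arXiv:1007.0575 §3; DuminilCopinHammond2013; LawlerSchrammWerner2004SAW §3;
Dyhr–Gilbert–Kennedy–Lawler–Passon, J. Stat. Phys. 2011 (strip SAW exit density); card
`FlatGateBudget`/`GateMassGrowth`; TRIAGE r1-1 sharpen 1, r1-2 (gate layer). -/
theorem stub_gateMassBudget : GateMassBudget := by
  sorry

/-- STUB 3 — `GateL1Bound` (size XL; OPEN — second hardest; the a-priori bound every line of this
crux owes, TRIAGE r1-1 cross-card remark 2).  Why plausible: on compacts of `Ω` it is NECESSARY
for the target (Banach–Steinhaus) and is the weak shadow of `F_δ/F_δ(b_δ) → c(Φ'/Φ'(b))^{5/8}`;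
engines in the pool: WindingAlias `NormalisedMassBound` (stmt-14032), the cup's `InteriorL2Harnack`,
dressed-arrival's positive-budget compactness for `C²` data (`|Λ_δ(ψ)| ≤ C_K‖ψ‖_{L¹}`, Φ-free,
margin `11/48`), the corrected `PhaseSectorInMass` of sector-bootstrap (phase-only hypothesis +
positive budgets ⇒ this bound, feet included).  The extension to compacts touching the open gate is
the same cancellation in the rigid half-lattice geometry (conjectural limit continuous up to the
open flat piece by reflection).  Why it might fail: it IS the exponent-sharp cancellation
`|F_δ| ≍ δ^{25/48} Z_δ` summed over a region (failure mode 2 of the crux); `DefectDecoherence`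
controls only the incoherent star mode, not the signal `|S(v)|` (TRIAGE r1-3 note 3).
Sources: arXiv:1007.0575 Conj. 2; arXiv:1009.6077 Q3/Q5; KennedyLawler2013; card `GateL1Bound`;
`Ideas/sector-bootstrap.md`, `Ideas/dressed-arrival-cauchy-transform.md`; TRIAGE r1-1/2/3. -/
theorem stub_gateL1Bound : GateL1Bound := by
  sorry

/-- STUB 4 — the DISCRETE HALF: `WeightedGreenIdentity → GateMassBudget → BoundaryWindingRigidity →
DefectDecoherence → MassRatio → GatePairingLimit` (size L–XL; provable given its inputs — Taylor
bookkeeping + three regional estimates, with NO `|F|` a-priori bound: every error term carries a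
power of `δ` and is paid in positive masses; this is where the crux hypotheses DD, MR are consumed,
exactly once).  Scheme, for a frame, a weight `w ∈ C³` vanishing on an open
`U ⊇ A := ∂Ω ∖ ball(pt 1, ρ/4)` (hence on a uniform `η₀`-collar of the compact `A`), and
`η' := min(η₀, ρ/8)`:
(0) GATE GEOMETRY AND PHASE: eventually every boundary mid-edge `e = {v ∈ Λ, u ∉ Λ}` of `Λ_δ` has
its inside vertex within `η₀` of `∂Ω` (exhaustion applied to `{dist(·,∂Ω) ≥ η₀/2} ∩ Ω̄`), so either
`w` and its derivatives vanish at `δc_v`, `δ·mid e`, or `e` lies in the slab above the gate inside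
`ball(pt 1, ρ/2)`, where `Λ_δ` is the exact half-lattice: `e` is the vertical dangling edge below an
up-face of row `m 1 δ`, `mid e − c_v = −iℓ/2`, and `F_δ(e)/F_δ(b_δ) = Z_δ(e)/Z_δ(b_δ) ≥ 0` — all
walks `a_δ → e` have one winding (`BoundaryWindingRigidity`), equal to that of `a_δ → b_δ` because
the boundary arc of `R(Λ_δ)` between two floor danglers inside the ball is the zigzag row (net
tangent rotation `0`) and does not contain `a_δ` (disjoint balls): discrete Umlaufsatz (tree
`HopfClosed`, `PolygonWinding`, `HexSAWHopfPath`); also `|F_δ(b_δ)| = Z_δ(b_δ)`.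
(1) TAYLOR: `u_v − u_w = −δ[∂w·d + ∂̄w·d̄](δ·mid) + O(δ³ℓ³‖w‖_{C³})` (`d = c_w − c_v`, odd expansion),
so the identity reads `δ²Σ_e ∂̄w F/F(b) + (δ²/ℓ²)Σ_e d²∂w F/F(b) + (i/ℓ) δ Σ_gate w(δc_v) F/F(b)
= O(δ⁴‖w‖_{C³}) Σ_{supp} |F|/|F(b)|`; `d² = ∓iℓ d̄` (black→white / white→black) groups the twisted
sum by black vertex into `Σ_v [2T(v) ∂w(δc_v) + O(δ‖w‖_{C²}) M_v]` with `T(v)` the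
`DefectDecoherence` quantity and `M_v = Σ_t Z(vt) ≥ Σ_t |F(vt)|`; `w(δc_v) = w(δ·mid e) + O(δ‖∇w‖)`
on the gate.
(2) BULK (`dist(δc_v, ∂Ω) ≥ η'`): `|T(v)| ≤ C(η'/2δ)^{−θ} M_v` (DD; the lattice ball of radius
`η'/2δ` lies in a fixed compact of `Ω`, inside `Λ_δ` by exhaustion) and `δ²Σ M_v ≤ Cδ^{−3/4} Z(b_δ)`
(MR, instantiated with the single threshold `m 1`): `O(η'^{−θ} δ^{θ−3/4}) → 0`; Taylor remainders
`O(δ · δ^{−3/4})`.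
(3) GATE LAYER (rows `m 1 δ + k`, `2 ≤ k ≤ 2η'/(√3 δ)`, inside `ball(pt 1, ρ/4 + η')`; each vertex is
`(√3 k/2 − 1)`-deep because the ball is the exact half-lattice): DD + `GateMassBudget`:
`δ² Σ_k k^{−θ} · C (k+1)^{3/4} Z(b)/δ / Z(b) = O(δ Σ_{k ≤ η'/δ} k^{3/4−θ}) = O(η'^{7/4−θ} δ^{θ−3/4})
→ 0` iff `θ > 3/4` — the route's cut; rows `k = 0, 1` (not deep) by `|T(v)| ≤ ℓ M_v` and the budget:
`O(δ)`; the gate Taylor shift `O(δ)` by the budget at `k = 0`.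
(4) REMAINDERS: `∂̄w` is paired as is (the cutoff band and its feet are the business of stub 7, via
`GateL1Bound`); the Taylor remainders use `|F| ≤ Z`: over the bulk `O(δ³ · δ^{−3/4})` (MR), over
the part of `supp ∇w` within `η'` of the gate `O(δ³ (η'/δ)^{7/4} δ^{−1}) = O(η'^{7/4} δ^{1/4})`
(budget); extending the interior edge sum to all domain mid-edges costs `O(δ)` (gate danglers,
budget).
Why it might fail: only through its inputs (the bookkeeping was re-derived independently by
TRIAGE r1-1 (i)–(ii) and r1-2); lattice-geometry slips (floating floor height `h_δ → im pt 1`,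
rim of the ball) are handled by (0).  Sources: arXiv:1007.0575 Lemma 1, §4 (curl remark);
arXiv:1009.6077 §5; route items 8549/8550/8515/8558; card Lever; TRIAGE r1-1 (i)(ii), r1-2. -/
theorem stub_discreteGreenOnGate :
    WeightedGreenIdentity → GateMassBudget → BoundaryWindingRigidity →
      DefectDecoherence → MassRatio → GatePairingLimit := by
  sorry

/-- STUB 5 — `RungeGate` (size L–XL; classical, PROVABLE NOW modulo vendoring).  Ingredients:
(a) Cauchy transform `Tψ(z) = −(1/π)∫∫ ψ(ζ)/(ζ − z) dA` of `ψ ∈ C³_c`: `Tψ ∈ C³`, `∂̄Tψ = ψ`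
(Cauchy–Pompeiu; differentiate under the integral after the change of variables `ζ ↦ z + ζ`),
holomorphic on `ℂ ∖ supp ψ`; (b) Runge's theorem, polynomial form: `K` compact with `ℂ ∖ K`
connected, `f` holomorphic near `K` ⇒ uniform polynomial approximation on `K` (pole pushing from the
Cauchy formula on a grid contour; Rudin RCA 13.6–13.9, Gaier ch. II); `C²` smallness on the
slightly smaller collar by Cauchy estimates; (c) topology: `A := frontier Ω ∖ ball(pt 1, ρ/4)` is
compact, `N := {dist(·,A) ≤ η/2}`, and for `η < η₀` the set `supp ψ` lies in the unbounded
component of `ℂ ∖ N` — join `supp ψ` to a point above the gate inside `Ω` (connected, open: a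
compact path at positive distance from `∂Ω`), cross the gate gap vertically (the flat clause:
lower half-ball ⊆ exterior), and run to `∞` in the exterior of the Jordan curve (connected,
unbounded; tree `JordanDomain` API / Jordan curve theorem files) — so `Tψ` is holomorphic near the
polynomial hull `N̂`; (d) smooth cutoff `χ` with `χ = 0` on `{dist(·,A) < η/4}`, `χ = 1` off
`{dist(·,A) < η/2}` (`exists_contDiff_tsupport_subset` / smooth Urysohn), `w := χ (Tψ + h_ε)`,
`B := {η/4 ≤ dist(·,A) ≤ η/2}`; `∂̄w − ψ = (Tψ + h_ε) ∂̄χ` on `B`, `= 0` off `B` (`ψ = 0` within `η`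
of `∂Ω` for `η` small); points of `B ∩ Ω̄` on `∂Ω` are at distance `≥ η/4` from `A`, hence on the
flat row inside `ball(pt 1, ρ/4) ⊆ gateSeg(ρ/2)`.  Why it might fail: it does not (classical);
cost only.  Sources: Rudin, Real and Complex Analysis, Thm 13.6/13.9 and 20.3-type Cauchy–Pompeiu;
Gaier, Lectures on Complex Approximation, ch. II; Hörmander SCV Thm 1.2.1; card Lever / Leans on;
TRIAGE r1-1 (ii), r1-2 (Runge geometry), r1-3. -/
theorem stub_rungeGate : RungeGate := by
  sorry

/-- STUB 6 — `FlatGateProfile` (size XL; OPEN — the HARDEST stub, the line's ONE Φ-dependent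
input, filed as a declared open input with its own engine as TRIAGE r1-2 sharpen R1 asks).  Why
plausible: (i) it is a statement about RATIOS OF POSITIVE arrival masses at points of ONE exact
flat row (one edge class: no Kennedy–Lawler factor, no phase, no tangent), domain-monotone in the
numerator, transfer-matrix falsifiable; (ii) its `ℤ²` physics — the `(5/8)`-covariant exit density
of SAW along a flat wall — was tested to Monte-Carlo precision by Dyhr–Gilbert–Kennedy–Lawler–Passon
(2011); (iii) it is plausibly EQUIVALENT to the target given DD, MR, `GateL1Bound` (read
`GatePairingLimit` backwards on the family `{w^ψ_ε|_gate}`), so it does not overshoot the crux;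
(iv) ENGINE in the pool: the sibling line `polygon-squeeze-flux-trace` (ArrivalMonotone — provable
now — squeezes `α^b_δ` of `(Ω, Λ_δ)` between those of canonical hex-polygons `P_δ ⊆ Λ_δ ⊆ P'_δ`
built on the SAME floor rows; `PolygonCase` (Conj.-2 boundary law on one-class polygons: finite-index
RH problem given compactness, the regime the 8536 panel certified for the cup/Schwarz–Christoffel)
and `CollarAvoidance` for polygon families pinch the squeeze), alternatively two-root-quotient's
`stub_flatTrace` (ii) (registered on this crux) up to its constant.  Toy (TRIAGE r1-1,
profile_run1.out, half-discs `R ≤ 4`): ratios `1.007, 0.979, 1.000, 1.055, 1.144` at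
`x = −0.5 … 0.5` against the Möbius-corrected prediction — consistent, pre-asymptotic.  Why it
might fail: it carries the full conformal content of Conj. 2 on the gate (shape dependence through
`Φ'`); a lattice-dependent but non-conformal limiting profile, or no limit, kills the line (and, by
(iii), signals trouble for the target itself on that domain).  Cheapest falsifier (kit): critical
hexagonal SAW in rectangles of width `W = 6…12` with exact zigzag floor, `r_W(x) = Z(a→e_x)/Z(a→b)`
against `(Φ_W'(x)/Φ_W'(b))^{5/8}` (elliptic functions), drift between `W` and `2W`.
Sources: arXiv:1007.0575 Conj. 2; LawlerSchrammWerner2004SAW §3–4 (restriction exponent 5/8);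
Lawler, J. Stat. Phys. 2009 (doi:10.1007/s10955-009-9704-6: `Z_D(a,x) ∝ |f'(a)f'(x)|^{5/8}`);
Dyhr–Gilbert–Kennedy–Lawler–Passon, J. Stat. Phys. 144 (2011); KennedyLawler2013 (arXiv:1109.3091);
`Ideas/polygon-squeeze-flux-trace.md`; TRIAGE r1-1 (iv), r1-2 R1/P6, r1-3 sharpen 1–2. -/
theorem stub_flatGateProfile : FlatGateProfile := by
  sorry

/-- STUB 7 — the ANALYTIC CLOSING `GatePairingLimit → RungeGate → FlatGateProfile → GateL1Bound →
GateTarget` (size L; classical given its inputs; the card's `Transfer:` `C⁺ ⟹ X`).  For a frame with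
disjoint balls and `ψ ∈ C_c(Ω)`:
(a) `C³` CASE.  Take `B` and, for each `ε`, `w_ε` from `RungeGate`; `g_ε := ∂̄w_ε − ψ`.  Linearity of
`Λ_δ` gives `Λ_δ(ψ) = Λ_δ(∂̄w_ε) − Λ_δ(g_ε)`; `GatePairingLimit`: `Λ_δ(∂̄w_ε) = −i√3 G_δ(w_ε) + o(1)`
with `G_δ` the gate pairing; `FlatGateProfile` applied to `g := θ·w_ε ∈ C_c(ball(pt 1, ρ/2))` (`θ` a
cutoff `≡ 1` on the slab where gate midpoints with `w_ε ≠ 0` live — eventually `G_δ(w_ε) = G_δ(g)`,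
by the vanishing of `w_ε` near `A` and `δ·mid b_δ → pt 1`) gives `G_δ(w_ε) → ∫ w_ε m_b dx`, where
`L̄` is built by Schwarz reflection of `Φ` across the flat piece (`Φ' ≠ 0`, real `> 0` on the open
gate; the gate avoids the pole `pt 0`); `|Λ_δ(g_ε)| ≤ ε · C_B` eventually by `GateL1Bound` with the
fixed compact `B` (`B ∩ Ω̄ ⊆ Ω ∪ gateSeg(ρ/2)`).  Hence `limsup_δ |Λ_δ(ψ) − A_ε| ≤ εC_B` with
`A_ε := −i√3 ∫ w_ε m_b`; so `|A_ε − A_ε'| ≤ (ε+ε')C_B`, `A_ε → A` and `Λ_δ(ψ) → A` (existence, no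
subsequence).  Identification: `f := exp((5/8)(L − L_b))` is holomorphic on `Ω` (`exp L = Φ'`),
continuous up to the open gate with boundary values `m_b`'s density (FlatGateProfile's `L̄`); Green
on `Ω_τ := {z ∈ Ω : w_ε-support side, im z > im pt 1 + τ}` with smooth boundary where `w_ε f ≠ 0`
only along the bottom segment: `∫∫_{Ω_τ} ∂̄w_ε f dA = (1/2i) ∫ w_ε f dx|_{height τ} → (1/2i)∫_gate
w_ε f dx` (`τ → 0`); so `∫∫_Ω ψ f = (1/2i)∫_gate w_ε f dx − ∫∫_B g_ε f`, `|∫∫_B g_ε f| ≤ ε ∫_{B∩Ω}|f|`,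
whence `A_ε = −i√3 · 2i (∫∫ ψ f + O(ε)) → 2√3 ∫∫ ψ f`: `c = 2√3`.
(b) DENSITY `C³ → C⁰` (TRIAGE r1-3 note 3, stated here rather than hidden): mollify,
`ψ_n ∈ C³_c(K')` for a fixed compact `K' ⊆ Ω`, `‖ψ_n − ψ‖_∞ → 0`
(`ContDiffBump`-convolution, `HasCompactSupport.convolution`); `|Λ_δ(ψ) − Λ_δ(ψ_n)| ≤
‖ψ − ψ_n‖_∞ δ²Σ_{K'}|F|/|F(b)| ≤ C_{K'}‖ψ − ψ_n‖_∞` eventually (`GateL1Bound` on a compact of `Ω`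
— necessary-type there) and `|2√3∫(ψ − ψ_n) f| ≤ 2√3‖ψ − ψ_n‖_∞ ∫_{K'}|f|`; a `3ε`-argument on the
filter `𝓝[>] 0`.  Why it might fail: only through its inputs; the measure-theoretic glue (finsum
over `hexDomainMidEdges` = finite sum, `tendsto_finset_sum`, `intervalIntegral` vs set integral on
`Ioo`, `MeasureTheory.integral_prod` for Green on a half-slab) is routine but long.  Sources: card
Lever / Why it bites / Transfer; Rudin RCA (Green/Cauchy for `C¹` data); TRIAGE r1-1 (ii)
(existence + identification re-derived), r1-3 (runge verdict). -/
theorem stub_gateClosing :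
    GatePairingLimit → RungeGate → FlatGateProfile → GateL1Bound → GateTarget := by
  sorry

/-! ## Name-keyed aliases of the stub statements (hypotheses of the composition)

`Registered.stub_X` is the statement of `stub_X` under the registered stub's short name, so that
the skeleton audit (`#h21_check_skeleton`: hypotheses admissible iff registered obligations /
declared stubs BY NAME) accepts `BoundaryClosureR_of : Registered.stub_… → … → BoundaryClosureR`
(device of `Cruxes/BoundaryClosure/Lines/two-root-quotient.lean`). -/
namespace Registered

/-- Alias keyed by the registered stub name. -/
abbrev stub_weightedGreenIdentity : Prop := WeightedGreenIdentity
/-- Alias keyed by the registered stub name. -/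
abbrev stub_gateMassBudget : Prop := GateMassBudget
/-- Alias keyed by the registered stub name. -/
abbrev stub_gateL1Bound : Prop := GateL1Bound
/-- Alias keyed by the registered stub name. -/
abbrev stub_discreteGreenOnGate : Prop :=
  WeightedGreenIdentity → GateMassBudget → BoundaryWindingRigidity →
    DefectDecoherence → MassRatio → GatePairingLimit
/-- Alias keyed by the registered stub name. -/
abbrev stub_rungeGate : Prop := RungeGate
/-- Alias keyed by the registered stub name. -/
abbrev stub_flatGateProfile : Prop := FlatGateProfile
/-- Alias keyed by the registered stub name. -/
abbrev stub_gateClosing : Prop :=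
  GatePairingLimit → RungeGate → FlatGateProfile → GateL1Bound → GateTarget

end Registered

/-! ## The sorry-free part: shrinking the pins, the constant, and the composition -/

/-- The pinned frame is monotone in the pin radius: pins of radius `ρ` are pins of every radius
`ρ' ∈ (0, ρ]` (intersect the flat clause with the smaller ball; restrict the lattice clause). -/
theorem pinnedFrame_of_le {D : DobrushinDomain} {ρ ρ' : ℝ} {Λ : ℝ → Finset HexVertex}
    {m : Fin 2 → ℝ → ℤ} {a b : ℝ → Sym2 HexVertex} (hρ' : 0 < ρ') (hle : ρ' ≤ ρ)
    (h : PinnedFrame D ρ Λ m a b) : PinnedFrame D ρ' Λ m a b := by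
  obtain ⟨-, hflat, hadm, hexh, ha, hb⟩ := h
  have hsub : ∀ i : Fin 2, ball (D.pt i) ρ' ⊆ ball (D.pt i) ρ := fun i => ball_subset_ball hle
  refine ⟨hρ', fun i => ?_, ?_, hexh, ha, hb⟩
  · ext z
    constructor
    · rintro ⟨hz, hzb⟩
      have hz' : z ∈ {z : ℂ | (D.pt i).im < z.im} ∩ ball (D.pt i) ρ := by
        rw [← hflat i]; exact ⟨hz, hsub i hzb⟩
      exact ⟨hz'.1, hzb⟩
    · rintro ⟨hz, hzb⟩
      have hz' : z ∈ D.carrier ∩ ball (D.pt i) ρ := by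
        rw [hflat i]; exact ⟨hz, hsub i hzb⟩
      exact ⟨hz'.1, hzb⟩
  · filter_upwards [hadm] with δ hδ
    exact ⟨hδ.1, hδ.2.1, hδ.2.2.1, hδ.2.2.2.1, hδ.2.2.2.2.1, hδ.2.2.2.2.2.1,
      fun i v hv => hδ.2.2.2.2.2.2 i v (hsub i hv)⟩

/-- The line's universal constant `c = 2√3` is non-zero. -/
theorem two_mul_sqrt_three_ne_zero : ((2 * Real.sqrt 3 : ℝ) : ℂ) ≠ 0 := by
  have h : (0 : ℝ) < 2 * Real.sqrt 3 := by positivity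
  exact_mod_cast h.ne'

/-- **`GateTarget → HexObservableLimitR` (kernel-checked).**  Take `c := 2√3`; given a frame of
the target with pins of radius `ρ`, shrink to `ρ' := min ρ (|pt 0 − pt 1|/3)` (the marked points of
a Dobrushin domain are distinct), so that the two pinned balls are disjoint and the gate avoids the
root, repackage the hypotheses as `PinnedFrame`/`ConformalFrame`, and apply `GateTarget` — its
conclusion does not mention `ρ`. -/
theorem hexObservableLimitR_of_gateTarget (hGT : GateTarget) : HexObservableLimitR := by
  refine ⟨((2 * Real.sqrt 3 : ℝ) : ℂ), two_mul_sqrt_three_ne_zero, ?_⟩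
  intro D ρ Λ m a b Φ L Lb ψ F hρ hflat hadm hexh ha hb hΦ hΦb hL hexpL hLb hψc hψK hψD
  have h01 : D.pt 0 ≠ D.pt 1 := fun h => absurd (D.pt_injective h) (by decide)
  have hdpos : 0 < dist (D.pt 0) (D.pt 1) := dist_pos.2 h01
  set ρ' : ℝ := min ρ (dist (D.pt 0) (D.pt 1) / 3) with hρ'def
  have hρ'pos : 0 < ρ' := lt_min hρ (by positivity)
  have hρ'le : ρ' ≤ ρ := min_le_left _ _
  have hsep : 2 * ρ' < dist (D.pt 0) (D.pt 1) := by
    have h3 : ρ' ≤ dist (D.pt 0) (D.pt 1) / 3 := min_le_right _ _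
    linarith
  have hPF : PinnedFrame D ρ' Λ m a b :=
    pinnedFrame_of_le hρ'pos hρ'le ⟨hρ, hflat, hadm, hexh, ha, hb⟩
  have hCF : ConformalFrame D Φ L Lb := ⟨hΦ, hΦb, hL, hexpL, hLb⟩
  exact hGT D ρ' Λ m a b Φ L Lb ψ hPF hsep hCF hψc hψK hψD

/-- **The composition (kernel-checked, no `sorry`)**: the seven stubs — together with the route's
support item `BoundaryWindingRigidity` (stmt-CriticalPhenomena-8515), consumed BY NAME — imply
the crux `BoundaryClosureR` BY NAME.  Given the antecedents `DefectDecoherence`, `MassRatio`: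
STUB 4 (fed by STUBS 1, 2 and the support item) turns them into the discrete Green formula on the
gate; STUB 7 (fed by STUBS 5, 6, 3) closes to `GateTarget`; `hexObservableLimitR_of_gateTarget`
shrinks the pins and supplies `c = 2√3 ≠ 0`. -/
theorem BoundaryClosureR_of (h1 : Registered.stub_weightedGreenIdentity)
    (h2 : Registered.stub_gateMassBudget) (h3 : Registered.stub_gateL1Bound)
    (h4 : Registered.stub_discreteGreenOnGate) (h5 : Registered.stub_rungeGate)
    (h6 : Registered.stub_flatGateProfile) (h7 : Registered.stub_gateClosing)
    (hW : BoundaryWindingRigidity) :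
    Summit.CriticalPhenomena.SAWScalingLimit.Theses.SAWDefectDecoherence.BoundaryClosureR :=
  fun hDD hMR => hexObservableLimitR_of_gateTarget (h7 (h4 h1 h2 hW hDD hMR) h5 h6 h3)

/-- Wiring check: the registered stubs feed `BoundaryClosureR_of` as stated. -/
example (hW : BoundaryWindingRigidity) :
    Summit.CriticalPhenomena.SAWScalingLimit.Theses.SAWDefectDecoherence.BoundaryClosureR :=
  BoundaryClosureR_of stub_weightedGreenIdentity stub_gateMassBudget stub_gateL1Bound
    stub_discreteGreenOnGate stub_rungeGate stub_flatGateProfile stub_gateClosing hW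

end Summit.CriticalPhenomena.SAWScalingLimit.Cruxes.BoundaryClosureR.RungeGatedGreenPairing

end
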